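import Summits.BirchSwinnertonDyer.BirchSwinnertonDyer.Theorems.SchneiderFreeAdditiveX3GordTwoBranchIMCOfKYRead
import Summits.BirchSwinnertonDyer.BirchSwinnertonDyer.Theorems.SchneiderFreeAdditiveX3UpperWingSplit
import Summits.BirchSwinnertonDyer.BirchSwinnertonDyer.Theorems.SchneiderFreeAdditiveX3AnticycControlAdditiveKF
import HarnessLib

/-!
# Route `SchneiderFreeAdditiveX3` (rung K1 door) with its SECOND WING, SPLIT twist-unit datum: the FULL
# rank-one residue of X3♯ (`MissingPPartAt`, both halves of BSD_p) on B6 ∩ X3 ∩ sst-twist — one statement,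
# the wing's `hTU` WEAKENED to the field datum and the door in the KY-read short vocabulary

Cell `bsd-schneider-ideate`, seat `bsd-schneider-door-c5` (prover, generation 9); sequel to generation 8's
`…TwoWings.lean` (p486765 `missingPPartAt_sstTwist_of_door_of_wing`), executing memo
`memos/ROUTE-P2-upper-v2-g13.md` U34 (planner P2 gen 13, «@door-c5 (gen 9)»): the binder
`hTU : … → ∃ W₂ ∼ W, Upper.TwistUnitHeegnerDataAt W₂ p` is replaced by the WEAKER
`hTU : … → Upper.TwistUnitFieldAt W p` (SPLIT datum: a Heegner FIELD and a unit MEMBER, no point / torsion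
clause — memo §10: on the no-unit-at-`E` classes the bundled datum is unsatisfiable at every member while the
field datum is a finite certificate); and the DOOR side is read in door-c3 gen 8's short vocabulary
(`SchneiderFree.additiveX3RankOneLower_of_KYRead`: `PrintedFacts → ControlFacts → PotMultBranchIMC → RebasedFactsG
→ thm351_OPEN → KYReadCH → leaf`).

* `missingPPartAt_sstTwist_of_door_of_wingSplit`: DOOR (`PrintedFacts`, `ControlFacts`, crux r2
  `PotMultBranchIMC` (NONE), the three cite-only facts of the rebased road, `hKY` (KY Thm. 3.5.1, PRE),
  `hCH : KYRead.KYReadCH` (CH18 at `𝔭′`, untyped)) + WING (`hCoG` / `hCoM` = the co-sockets at KY-normalised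
  curves of each cell, candidates `GordTwoBranchCoIMC` (PRE-bound) / `PotMultBranchCoIMC` (NONE); `hTU` = the
  SPLIT twist-unit datum on the cell, candidate `TwistUnitX3Split`) ⟹ `MissingPPartAt W p` on the whole cell.
* `missingPPartAt_sstTwist_of_lower_of_coChain_of_twistUnitField`: the same residue from the door's rung
  leaf `SchneiderFree.AdditiveX3RankOneLower` as ONE hypothesis + the wing's TWO inputs in split form (`hG` =
  the body of the memo's `GoodMemberCoChainX3`, `hT` = the body of `TwistUnitX3Split`) + seven printed facts —
  the shape a sibling route's `closes` would compose (memo U25/U33(b)); the Props themselves are NOT declared.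

HONEST FRAMING: CONDITIONAL on every displayed hypothesis — r2 and `hCoM` have NO print, `hKY` / `hCoG`'s
content rest on a PREPRINT, `hCH` is untyped print, `hTU` is a certificate per pair / open class-wide; no item
is closed, no rung leaf for the wing is registered, and BSD is NOT advanced beyond this typed reduction.

References: [JetchevSkinnerWan2017] §7.4.1; [KellerYin2024b] arXiv:2410.23241 Thm. 3.5.1; [CastellaHsieh2018]
Thm. 5.7, Lemma 5.4; [Miller2011LMS] Def. 1.1; [GrossZagier1986] I.(6.3), (7.3); [KrizLi2019] Thm. 1.20.
-/

noncomputable section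

open scoped Classical

open Field NumberField IsDedekindDomain WeierstrassCurve
open Literature.NumberTheory.EllipticCurves Literature.NumberTheory.EllipticCurves.GreenbergSelmer
open Literature.NumberTheory.GaloisRepresentations
open Literature.NumberTheory.GaloisCohomology
open Literature.NumberTheory.EllipticCurves.ModularForms
  Literature.NumberTheory.EllipticCurves.CaiShuTian2014
  Literature.NumberTheory.EllipticCurves.KellerYin2024
  Literature.NumberTheory.EllipticCurves.Rank1Residual
  Literature.NumberTheory.EllipticCurves.Rank1Residual.Typed
  Summit.BirchSwinnertonDyer.Rank1Residual
  Summit.BirchSwinnertonDyer.Rank1Residual.X11b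
  Summit.BirchSwinnertonDyer.BirchSwinnertonDyer.Theorems.SchneiderFree
  Summit.BirchSwinnertonDyer.BirchSwinnertonDyer.Theorems.SchneiderFree.KYRead

set_option linter.dupNamespace false
set_option autoImplicit false

namespace Summit.BirchSwinnertonDyer.BirchSwinnertonDyer.Theorems.SchneiderFreeAdditiveX3

open Summit.BirchSwinnertonDyer.BirchSwinnertonDyer.Theses.SchneiderFreeAdditiveX3

/-- **FULL BSD_p residue (both halves, `MissingPPartAt`) on B6 ∩ X3 ∩ sst-twist in analytic rank one — the
door's inputs (KY-read short vocabulary) + the second wing's inputs with the SPLIT twist-unit datum (U34).**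
DOOR: `PrintedFacts`, `ControlFacts`, `PotMultBranchIMC` (r2, (M), NONE), Gross 2004 ∧ CM-rationality ∧ CST
Thm. 1.1 (cite-only), `hKY` (KY 3.5.1, PRE), `hCH : KYReadCH` (CH18 at `𝔭′`, untyped). WING: `hCoG` (co-socket at
KY-normalised (G-ord, `e = 2`) curves), `hCoM` (the same on (M); NONE), `hTU` (the SPLIT twist-unit datum
`Upper.TwistUnitFieldAt` on the cell: a Heegner field of `W` with `L(W^{d_K},1) ≠ 0` and a `p`-unit `#Ш_an` at the
twist of SOME member — strictly weaker than generation 8's bundled member datum). The control EQUALITY the wing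
consumes is the CLOSED item `AnticycControlAdditiveKF` fed `ControlFacts` + Kolyvagin. CONDITIONAL on every
displayed hypothesis; closes no item; BSD NOT advanced. [cite: JetchevSkinnerWan2017, §7.4.1 (arXiv:1512.06894 p. 30)]
[cite: KellerYin2024b, Thm. 3.5.1 (arXiv:2410.23241 p. 20) (preprint; hypotheses hKY/hCoG)]
[cite: CastellaHsieh2018, Thm. 5.7 and Lemma 5.4 (arXiv:1505.08165 pp. 17–19) (shape of hCH; untyped)]
[cite: Miller2011LMS, Def. 1.1] [cite: KrizLi2019, Thm. 1.20 (shape of hTU)] -/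
theorem missingPPartAt_sstTwist_of_door_of_wingSplit (hF : PrintedFacts) (hCF : ControlFacts)
    (h2 : PotMultBranchIMC)
    (hR : Gross2004.rankinLSeries_eq_mul_quadraticTwist ∧ phi_heegnerPointOfConductor_mem_ringClassField ∧
      thm11_ringClassChar)
    (hKY : thm351_imc_isTorsion_mu_zero_charIdeal_eq_OPEN) (hCH : KYReadCH)
    (hCoG : ∀ (W : WeierstrassCurve ℚ) [W.IsElliptic] [W.IsGloballyMinimal] (p : ℕ) [Fact p.Prime],
      p ≠ 2 → ClassX3 W p → Additive.SubGordTwo W p →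
      (∃ Φ : AddSubgroup (geomTorsion W (p : ℤ)), IsRationalLine W p Φ ∧ ¬ LineDecompositionTrivialAt W p Φ) →
      Upper.AdditiveIMCUpperBDPInputManinAt W p)
    (hCoM : ∀ (W : WeierstrassCurve ℚ) [W.IsElliptic] [W.IsGloballyMinimal] (p : ℕ) [Fact p.Prime],
      p ≠ 2 → ClassX3 W p → Additive.SubM W p →
      (∃ Φ : AddSubgroup (geomTorsion W (p : ℤ)), IsRationalLine W p Φ ∧ ¬ LineDecompositionTrivialAt W p Φ) →
      Upper.AdditiveIMCUpperBDPInputManinAt W p)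
    (hTU : ∀ (W : WeierstrassCurve ℚ) [W.IsElliptic] [W.IsGloballyMinimal] (p : ℕ) [Fact p.Prime],
      W.analyticRank = 1 → p ≠ 2 → ClassX3 W p → Additive.SubSemistableTwist W p →
      Upper.TwistUnitFieldAt W p) :
    ∀ (W : WeierstrassCurve ℚ) [W.IsElliptic] [W.IsGloballyMinimal] (p : ℕ) [Fact p.Prime],
      W.analyticRank = 1 → p ≠ 2 → ClassX3 W p → Additive.SubSemistableTwist W p → MissingPPartAt W p := by
  -- the door: lower half on the whole cell (KY-read short vocabulary, door-c3 gen 8)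
  have hLow : Summit.BirchSwinnertonDyer.BirchSwinnertonDyer.Theorems.SchneiderFree.AdditiveX3RankOneLower :=
    additiveX3RankOneLower_of_KYRead hF hCF h2 hR hKY hCH
  obtain ⟨hGZ, hKo, hGZK, hmod, hPar, hCas, hGZ73, -, -, hHP, -, -, -⟩ := hF
  -- the control EQUALITY on the cell (item 19548, CLOSED) from `ControlFacts` + Kolyvagin
  have hCtl := anticycControlAdditiveKF_proof hCF.1 hCF.2.1 hCF.2.2.1 hCF.2.2.2 hKo
  intro W _ _ p _ hr hp2 hX hS
  exact missingPPartAt_of_lower_of_upper W p (hLow W p hr hp2 hX hS)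
    (Upper.missingUpperBoundAt_sstTwist_of_coIMCs_of_control_of_twistUnitField hGZ hKo hGZK hmod hPar hGZ73
      hCas hHP hCtl hCoG hCoM hTU W p hr hp2 hX hS)

/-- **FULL BSD_p residue on the door from the door's RUNG LEAF and the wing's TWO inputs (split form).**
`SchneiderFree.AdditiveX3RankOneLower` (rung K1's registered leaf, as ONE hypothesis — whatever closes the door
supplies it) + seven printed facts (GZ I.(6.3), Kolyvagin, GZK, modularity, GZ I.(7.3), Cassels, Heegner
points over `K`) + `hG` (some member runs the co-chain over every imaginary quadratic Heegner field with
`p ∤ d_K` — the body of the memo's derived node `GoodMemberCoChainX3`) + `hT` (the split twist-unit datum on the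
cell — the body of the memo's crux `TwistUnitX3Split`) ⟹ `MissingPPartAt W p` on the whole cell. The two Props
and the wing's rung-leaf candidate are NOT declared in the tree (route items on the director's U25 ruling);
this is the composition a sibling route's deciding theorem would perform. CONDITIONAL on `hLow`, `hG`, `hT`;
closes no item; BSD NOT advanced. [cite: Miller2011LMS, Def. 1.1] [cite: GrossZagier1986, Thm. I.(6.3) and (7.3)]
[cite: JetchevSkinnerWan2017, §7.4.1] -/
theorem missingPPartAt_sstTwist_of_lower_of_coChain_of_twistUnitField
    (hLow : Summit.BirchSwinnertonDyer.BirchSwinnertonDyer.Theorems.SchneiderFree.AdditiveX3RankOneLower)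
    (hGZ : ∀ (N : ℕ) [NeZero N] (W : WeierstrassCurve ℚ) (K : Type) [Field K] [NumberField K],
      gross_zagier N W K)
    (hKo : ∀ (N : ℕ) [NeZero N] (W : WeierstrassCurve ℚ) (K : Type) [Field K] [NumberField K],
      kolyvagin N W K)
    (hGZK : rank_eq_analyticRank_of_analyticRank_le_one) (hmod : hasEntireLFunction_rat)
    (hGZ73 : GrossZagier1986_thm_I_7_3) (hCassels : bsdRHS_eq_of_isIsogenous)
    (hHP : ∀ (W : WeierstrassCurve ℚ) (K : Type) [Field K] [NumberField K], exists_isHeegnerPoint W K)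
    (hG : ∀ (W : WeierstrassCurve ℚ) [W.IsElliptic] [W.IsGloballyMinimal] (p : ℕ) [Fact p.Prime],
      W.analyticRank = 1 → p ≠ 2 → ClassX3 W p → Additive.SubSemistableTwist W p →
      ∀ (K : Type) [Field K] [NumberField K], IsImaginaryQuadratic K →
        SatisfiesHeegnerHypothesis (W.conductorNorm ℤ) K → ¬ (p : ℤ) ∣ NumberField.discr K →
        ∃ (W₁ : WeierstrassCurve ℚ) (_ : W₁.IsElliptic) (_ : W₁.IsGloballyMinimal),
          IsIsogenous W W₁ ∧ W₁.conductorNorm ℤ = W.conductorNorm ℤ ∧ Additive.N10.Locus W₁ p ∧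
          (∀ Q : (W₁.baseChange K).toAffine.Point, p • Q = 0 → Q = 0) ∧
          Upper.AdditiveCoStepLInputManinAt W₁ p)
    (hT : ∀ (W : WeierstrassCurve ℚ) [W.IsElliptic] [W.IsGloballyMinimal] (p : ℕ) [Fact p.Prime],
      W.analyticRank = 1 → p ≠ 2 → ClassX3 W p → Additive.SubSemistableTwist W p →
      Upper.TwistUnitFieldAt W p) :
    ∀ (W : WeierstrassCurve ℚ) [W.IsElliptic] [W.IsGloballyMinimal] (p : ℕ) [Fact p.Prime],
      W.analyticRank = 1 → p ≠ 2 → ClassX3 W p → Additive.SubSemistableTwist W p → MissingPPartAt W p := by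
  intro W _ _ p _ hr hp2 hX hS
  exact missingPPartAt_of_lower_of_upper W p (hLow W p hr hp2 hX hS)
    (Upper.missingUpperBoundAt_sstTwist_of_coChain_of_twistUnitField hGZ hKo hGZK hmod hGZ73 hCassels hHP hG
      hT W p hr hp2 hX hS)

end Summit.BirchSwinnertonDyer.BirchSwinnertonDyer.Theorems.SchneiderFreeAdditiveX3

end
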